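import Summits.BirchSwinnertonDyer.BirchSwinnertonDyer.Theorems.ByReductionTypeAtTwoRankOneAtTwoBigImageOddLocalOneDoorBottomCebotarev
import HarnessLib

/-!
# Route ByReductionTypeAtTwo, crux `RankOneAtTwoBigImageOddLocal` (stmt-BirchSwinnertonDyer-23715), LINE v8.9 `one_door_analytic`:
# the Čebotarev leaves `ceb₁`, `ceb₂`, `ceb₂'` UNCONDITIONAL on the `Δ_W < 0` habitat

Width prover seat `bsd-line-fkl-p2` g10 (2026-08-28), `--supports stmt-BirchSwinnertonDyer-23715` (helper).  THEOREMS ONLY.  BSD is not proved by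
any of this.  Sibling of `…OneDoorBottomCebotarev.lean`: its `ceb₂_rat` / `ceb₁_rat` / `ceb₂'_rat` with the displayed input `hinjK` (no
inflation defect at level `2` over the door field) DISCHARGED by `hinjK_of_habitat` (same file, §0).  Habitat = route GenusKolyvaginAtTwo's
LINE 6 = the `Δ_W < 0` corner of the bottom rung: `W` globally minimal, non-CM, `Δ_W < 0`, `ρ_{W,2^n}` onto for all `n`; `K` imaginary
quadratic, `d_K` odd, `¬ IsSquare (d_K · (−|Δ_W|))`; `N` a multiple of the conductor.

References: [McCallumLMS1991] §3 Cor. 3.2; [GrossLMS1991] Prop. 9.1, §10; [Kolyvagin1989Izv] §3.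
-/

set_option autoImplicit false
-- the Theorems namespace of this sub repeats the summit name by design (D-0017 nested layout)
set_option linter.dupNamespace false

noncomputable section

open scoped Classical

namespace Summit.BirchSwinnertonDyer.BirchSwinnertonDyer.Theorems.RankOneAtTwoOneDoor

open WeierstrassCurve NumberField IsDedekindDomain Field
open Literature.NumberTheory.EllipticCurves Literature.NumberTheory.GaloisRepresentations

section Rat

variable (N : ℕ) [NeZero N] (W : WeierstrassCurve ℚ) [W.IsElliptic] [W.IsGloballyMinimal]
  {K : Type} [Field K] [NumberField K]

/-! ## §4 The leaves with `hinjK` discharged: unconditional on the habitat -/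

/-- **`ceb₂` UNCONDITIONAL on the habitat** (`ceb₂_rat` with `hinjK_of_habitat`). [cite: McCallumLMS1991, §3 Cor. 3.2] [cite: GrossLMS1991, Prop. 9.1, §10] -/
theorem ceb₂_rat_of_habitat (hN : W.conductorNorm ℤ ∣ N) (hcm : ¬ W.HasCM) (hΔ : W.Δ < 0) (hK : IsImaginaryQuadratic K)
    (hodd : Odd (NumberField.discr K)) (hns : ¬ IsSquare ((NumberField.discr K : ℚ) * -|W.Δ|))
    (hρ : ∀ n : ℕ, W.HasSurjectiveModNGaloisRep (2 ^ n : ℕ))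
    {θ : K} (hθ : θ ∉ Set.range (algebraMap ℚ K)) (hc : θ ^ 2 = algebraMap ℚ K ((NumberField.discr K : ℤ) : ℚ))
    (s y : galH1Torsion W ((2 : ℕ) : ℤ)) (hs0 : s ≠ 0) (hy0 : y ≠ 0) (hsy : s ≠ y) (b : ℕ) :
    ∃ ℓ : ℕ, b < ℓ ∧ FrobEqFrobInfty W K 2 ℓ ∧ Zhang2014.IsKolyvaginPrime N W K 2 ℓ ∧ 1 ≤ Zhang2014.kolyvaginIndex W 2 ℓ ∧
      ∀ v : HeightOneSpectrum (𝓞 ℚ), (ℓ : 𝓞 ℚ) ∈ v.asIdeal →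
        s ∉ W.torsionLocalKer (v.adicCompletion ℚ) ((2 : ℕ) : ℤ) ∧ y ∉ W.torsionLocalKer (v.adicCompletion ℚ) ((2 : ℕ) : ℤ) :=
  ceb₂_rat N W hN hcm hΔ hK hodd hns hρ hθ hc (hinjK_of_habitat W K hK hΔ hρ hns) s y hs0 hy0 hsy b

/-- **`ceb₁` UNCONDITIONAL on the habitat.** [cite: McCallumLMS1991, §3 Cor. 3.2] [cite: GrossLMS1991, §10] -/
theorem ceb₁_rat_of_habitat (hN : W.conductorNorm ℤ ∣ N) (hcm : ¬ W.HasCM) (hΔ : W.Δ < 0) (hK : IsImaginaryQuadratic K)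
    (hodd : Odd (NumberField.discr K)) (hns : ¬ IsSquare ((NumberField.discr K : ℚ) * -|W.Δ|))
    (hρ : ∀ n : ℕ, W.HasSurjectiveModNGaloisRep (2 ^ n : ℕ))
    {θ : K} (hθ : θ ∉ Set.range (algebraMap ℚ K)) (hc : θ ^ 2 = algebraMap ℚ K ((NumberField.discr K : ℤ) : ℚ))
    (y : galH1Torsion W ((2 : ℕ) : ℤ)) (hy0 : y ≠ 0) (b : ℕ) :
    ∃ ℓ : ℕ, b < ℓ ∧ FrobEqFrobInfty W K 2 ℓ ∧ Zhang2014.IsKolyvaginPrime N W K 2 ℓ ∧ 1 ≤ Zhang2014.kolyvaginIndex W 2 ℓ ∧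
      ∀ v : HeightOneSpectrum (𝓞 ℚ), (ℓ : 𝓞 ℚ) ∈ v.asIdeal → y ∉ W.torsionLocalKer (v.adicCompletion ℚ) ((2 : ℕ) : ℤ) :=
  ceb₁_rat N W hN hcm hΔ hK hodd hns hρ hθ hc (hinjK_of_habitat W K hK hΔ hρ hns) y hy0 b

/-- **`ceb₂'` UNCONDITIONAL on the habitat** (cross pair with distinct restrictions). [cite: McCallumLMS1991, §3 Cor. 3.2] [cite: Kolyvagin1989Izv, §3] -/
theorem ceb₂'_rat_of_habitat (hN : W.conductorNorm ℤ ∣ N) (hcm : ¬ W.HasCM) (hΔ : W.Δ < 0) (hK : IsImaginaryQuadratic K)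
    (hodd : Odd (NumberField.discr K)) (hns : ¬ IsSquare ((NumberField.discr K : ℚ) * -|W.Δ|))
    (hρ : ∀ n : ℕ, W.HasSurjectiveModNGaloisRep (2 ^ n : ℕ))
    {θ : K} (hθ : θ ∉ Set.range (algebraMap ℚ K)) (hc : θ ^ 2 = algebraMap ℚ K ((NumberField.discr K : ℤ) : ℚ))
    [(W.quadraticTwist ((NumberField.discr K : ℤ) : ℚ)).IsElliptic]
    (s' : galH1Torsion (W.quadraticTwist ((NumberField.discr K : ℤ) : ℚ)) ((2 : ℕ) : ℤ)) (y : galH1Torsion W ((2 : ℕ) : ℤ))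
    (hs0 : s' ≠ 0) (hy0 : y ≠ 0)
    (hne : hPsiKT W K hθ hc ((2 : ℕ) : ℤ) (resTorsion (W.quadraticTwist ((NumberField.discr K : ℤ) : ℚ)) K ((2 : ℕ) : ℤ) s') ≠
      resTorsion W K ((2 : ℕ) : ℤ) y)
    (b : ℕ) :
    ∃ ℓ : ℕ, b < ℓ ∧ FrobEqFrobInfty W K 2 ℓ ∧ Zhang2014.IsKolyvaginPrime N W K 2 ℓ ∧ 1 ≤ Zhang2014.kolyvaginIndex W 2 ℓ ∧
      ∀ v : HeightOneSpectrum (𝓞 ℚ), (ℓ : 𝓞 ℚ) ∈ v.asIdeal →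
        s' ∉ (W.quadraticTwist ((NumberField.discr K : ℤ) : ℚ)).torsionLocalKer (v.adicCompletion ℚ) ((2 : ℕ) : ℤ) ∧
          y ∉ W.torsionLocalKer (v.adicCompletion ℚ) ((2 : ℕ) : ℤ) :=
  ceb₂'_rat N W hN hcm hΔ hK hodd hns hρ hθ hc (hinjK_of_habitat W K hK hΔ hρ hns) s' y hs0 hy0 hne b

end Rat

end Summit.BirchSwinnertonDyer.BirchSwinnertonDyer.Theorems.RankOneAtTwoOneDoor

end
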